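import Summits.Schanuel.Schanuel.Theorems.ZilberEacGraphSurfaceUniqueTop
import Summits.Schanuel.Schanuel.Theorems.ZilberEacGraphSurfaceDictionary
import HarnessLib

/-!
# Mantova–Masser's density question over polynomial graphs of degree `≥ 2`: the literal residual
# theorem

HONEST FRAMING.  Cell `pub-schanuel` (Zilber's Exponential-Algebraic Closedness, case ladder;
host summit Schanuel), seat 2, gen 18.  Combining the dictionary lemma
(`exists_eq_graphSurface_of_mmCase`: a surface of the case over the graph `x₁ = p(x₀)` is a
`W(p; P)`) with gens 17–18 (`unprojectedDensityQuestion_graphSurface_of_y1`,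
`fibreCurveSurface_residual_of_not_unprojectedDense`):
**`mmCase_graphBase_residual`** — let `deg p ≥ 2` and let `W ⊆ ℂ² × ℂ²` be in Mantova–Masser's
case (dim-π-S-1-free) with base curve the graph of `p`.  If the exponential points of `W` are NOT
Zariski dense, then `W = {x₁ = p(x₀), P₂(x₀, y₀) = 0}` is a cylinder in `y₁` over an irreducible
fibre curve `P₂` with two `y₀`-degrees, `Re(lc(p)·i^{deg p}) = 0`, the row of maximal `x₀`-degree of
`supp P₂` reaches both extreme `y₀`-degrees, and every nonzero root `θ` of the top-row polynomial
satisfies `dτ log|θ| + σ = 0` — i.e. over polynomial graphs of degree `≥ 2` the question is decided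
(affirmatively) for every surface of the case outside this explicit EQUIMODULAR class.  Members of the
class: `{x₁ = -ix₀²/(2π), x₀(y₀ - 1) = 1}` (free; `e^{p(z_k)} → e^{-i/π}` along its exponential
points — a Schanuel/Shapiro-type question) and the non-free constant fibres `y₀ = θ`,
`|θ| = e^{-σ/(dτ)}` (where density can FAIL: `{x₁ = x₀²/(2πi), y₀ = 1}`, seat 1 gen 9).  NOT
Schanuel's conjecture (neither used nor implied; EAC ⇏ SC); `EC(3,2)` stays OPEN; the question stays
OPEN in general (PLMS 2024, §1 p. 5).
-/

noncomputable section

open Complex MvPolynomial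
open Literature.NumberTheory.Transcendental Literature.ModelTheory.Zilber
open Literature.ModelTheory.ExponentialFields

set_option linter.dupNamespace false

namespace Summit.Schanuel.Schanuel.Theorems

variable (p : Polynomial ℂ)

/-- **The residual theorem over polynomial graphs of degree `≥ 2`, literal form.**  See the module
docstring. [cite: MantovaMasser2023, §1 Further remarks, p. 5 (the question, open in general)]
(new) -/
theorem mmCase_graphBase_residual (hd : 2 ≤ p.natDegree) {W : Set (Fin 2 ⊕ Fin 2 → ℂ)}
    (hmm : MMCaseDimPiOneFree W)
    (hbase : zeroLocus ℂ (vanishingIdeal ℂ (projAdd '' (W ∩ torusLocus ℂ 2))) =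
      {x : Fin 2 → ℂ | x 1 = p.eval (x 0)})
    (hnot : ¬ UnprojectedDense W) :
    ∃ P₂ : MvPolynomial (Fin 2) ℂ, Irreducible P₂ ∧
      (∃ v ∈ P₂.support, ∃ v' ∈ P₂.support, v 1 ≠ v' 1) ∧
      W = {w : Fin 2 ⊕ Fin 2 → ℂ | w (Sum.inl 1) = p.eval (w (Sum.inl 0)) ∧
        MvPolynomial.eval ![w (Sum.inl 0), w (Sum.inr 0)] P₂ = 0} ∧
      (p.leadingCoeff * I ^ p.natDegree).re = 0 ∧
      (∀ v₀ ∈ P₂.support, (∀ v ∈ P₂.support, v 0 ≤ v₀ 0) →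
        (∃ vR ∈ P₂.support, vR 0 = v₀ 0 ∧ ∀ u ∈ P₂.support, u 1 ≤ vR 1) ∧
        (∃ vL ∈ P₂.support, vL 0 = v₀ 0 ∧ ∀ u ∈ P₂.support, vL 1 ≤ u 1)) ∧
      (∀ N₀ : ℕ, (∀ v ∈ P₂.support, v 0 ≤ N₀) → ∀ va ∈ P₂.support, ∀ vc ∈ P₂.support,
        va 0 = N₀ → vc 0 = N₀ → va 1 ≠ vc 1 → ∀ θ : ℂ, θ ≠ 0 →
        (∑ v ∈ P₂.support.filter (fun v : Fin 2 →₀ ℕ => v 0 = N₀),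
          Polynomial.C (P₂.coeff v) * Polynomial.X ^ (v 1)).eval θ = 0 →
        (p.natDegree : ℝ) * (p.leadingCoeff * I ^ (p.natDegree - 1)).re * Real.log ‖θ‖ +
          (p.coeff (p.natDegree - 1) * I ^ (p.natDegree - 1)).re = 0) := by
  classical
  obtain ⟨P, hP, hfib, hWP⟩ := exists_eq_graphSurface_of_mmCase p hmm hbase
  -- `P` has no monomial involving `y₁`, else `W` would be dense
  have h2 : ∀ m ∈ P.support, m 2 = 0 := by
    by_contra hsome
    push Not at hsome
    apply hnot
    rw [hWP]
    exact (unprojectedDensityQuestion_graphSurface_of_y1 p hd hP hsome hfib).2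
  obtain ⟨P₂, rfl⟩ := exists_rename_castSucc_eq h2
  have hirr₂ : Irreducible P₂ := irreducible_of_rename_castSucc hP
  have h1' : ∃ v ∈ P₂.support, ∃ v' ∈ P₂.support, v 1 ≠ v' 1 := by
    by_contra hall
    push Not at hall
    obtain ⟨v₀, hv₀⟩ := MvPolynomial.ne_zero_iff.1 hirr₂.ne_zero
    have hv₀s : v₀ ∈ P₂.support := MvPolynomial.mem_support_iff.2 hv₀
    have hfin := finite_fibres_of_sameDegree hirr₂.ne_zero (fun v hv => hall v hv v₀ hv₀s)
    refine hfib (hfin.subset ?_)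
    rintro t ⟨c, h0, -, hc⟩
    exact ⟨c 0, h0, by rwa [eval_vec3_rename_castSucc] at hc⟩
  have hW₂ : W = {w : Fin 2 ⊕ Fin 2 → ℂ | w (Sum.inl 1) = p.eval (w (Sum.inl 0)) ∧
      MvPolynomial.eval ![w (Sum.inl 0), w (Sum.inr 0)] P₂ = 0} := by
    rw [hWP, fibreCurveSurface_eq]
  have hnot₂ : ¬ UnprojectedDense {w : Fin 2 ⊕ Fin 2 → ℂ | w (Sum.inl 1) = p.eval (w (Sum.inl 0)) ∧
      MvPolynomial.eval ![w (Sum.inl 0), w (Sum.inr 0)] P₂ = 0} := by rwa [← hW₂]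
  obtain ⟨hre, hrow, hroot⟩ :=
    fibreCurveSurface_residual_of_not_unprojectedDense p hd hirr₂ h1' hnot₂
  exact ⟨P₂, hirr₂, h1', hW₂, hre, hrow, hroot⟩

end Summit.Schanuel.Schanuel.Theorems
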